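import Mathlib

/-!
# NE7K1LinSchurLineCoords — row NE7 (node U5), candidate route HOM, path H1L, cell K1-lin(s): the CHANGE-OF-VARIABLES layer
# for the interpolated-Schur propagator line — coercivity and the Combes–Thomas conjugation error of a CONGRUENT operator
# `H = c·Tᵀ M T` from those of `M`, for a weight-compatible (block-local) coordinate map `T`

Lineage `b2b-balaban-t4-ne7-p2` (CRUX PROVER NE7 #2), generation 63; third abstract piece of cell K1-lin(s) after
`Support/NE7K1LinSchurLine` (p284751 ✓, entrywise∕accretive currency) and `Support/NE7K1LinSchurLineForm` (p285160, form
currency).  WHY: in the intended instance run B's step-`j` fluctuation operator `M` (on run B's finer lattice; at `A = 0` the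
tree's `B4Lower18.fineOpR (L^{j+1}) a m² R′`) must be presented on coarse ⊕ fine coordinates `(V, ψ)` = (one-step block
means, in-block fluctuations) as `H₁ = c·Tᵀ M T` (`c` = the density ratio `L^{−(d+1)}` of the two Riemann sums, `T` the
block-local map `(V, ψ) ↦ φ′`), and `NE7K1LinSchurLineForm.lineOpR_inv_decay_form` wants for `H₁` (i) a coercivity floor and
(ii) a conjugation-error bound at a weight `ρ`.  THIS FILE ([folklore], Mathlib only, 0 Bałaban letters) supplies both
from the corresponding facts for `M` and two-sided bounds on `T`:
* `dot_congr_mulVec` — `⟨u′, (c·TᵀMT)u⟩ = c·⟨Tu′, M(Tu)⟩`;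
* **`coercive_congr`** — `σ_M‖φ‖² ≤ ⟨φ,Mφ⟩`, `c_T‖u‖² ≤ ‖Tu‖²`, `0 ≤ c, σ_M` ⇒ `(c·σ_M·c_T)‖u‖² ≤ ⟨u,(c·TᵀMT)u⟩`;
* `mulVec_weight_of_compat` — if `T x j ≠ 0 → ρ′ x = ρ j` (the weight is constant along `T`'s columns-to-rows incidence:
  in the instance, `ρ` constant on each coarse site's block and `ρ′ = ρ ∘ block`), then `T(f∘ρ · u) = (f∘ρ′)·(Tu)`;
* **`conjError_congr`** — under that compatibility the conjugation error is COVARIANT: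
  `err_ρ(c·TᵀMT, u) = c·err_{ρ′}(M, Tu)`;
* **`conjError_congr_ge`** — `−κ_M‖φ‖² ≤ err_{ρ′}(M,φ)`, `‖Tu‖² ≤ C_T‖u‖²`, `0 ≤ c, κ_M` ⇒
  `−(c·κ_M·C_T)‖u‖² ≤ err_ρ(c·TᵀMT, u)`.
So the `H₁`-hypotheses of the form theorem reduce to: `M`'s coercivity (B4 (1.8) one format finer — `B4Lower18.lower18`
at `A = 0`), `M`'s conjugation error (`Beta.CombesThomasForm.conjError_lap_ge` ∕ `conjError_blocks_ge` via
`B4Lower18.fineOpR_zero_eq_add`), and the two-sided bounds `c_T, C_T` of the block-local `T` (L- and d-dependent only).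

HONEST FRAMING: FIXED FINITE T⁴, rung (B)+1, CONDITIONAL on BetaPertH and the nine spine estimates (0/9 proved); NOT infinite
volume, NOT a mass gap, NOT Clay; NE7 NOT PRINTED ∕ NOT PROVED.  [folklore] finite real matrices; nothing printed asserted;
no `sorry`.  NOT NE7, NOT summit progress.  HONEST DEPENDENCY: continuum YM on T⁴ ⇐ BetaPertH ∧ nine spine estimates
(0/9 proved); BetaPertH ⇐ (D1) ∧ (D4) ∧ CAP+tail; G-an2-4 gates asym, D1 and NE2/3/4.
-/

noncomputable section

open Finset Matrix

namespace Summit.QuantumFields.BalabanUV.T4Continuum.NE7K1LinSchurLineCoords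

variable {ι κ : Type*} [Fintype ι] [Fintype κ]

/-- `⟨u′, (c·TᵀMT)u⟩ = c·⟨Tu′, M(Tu)⟩`. [folklore] -/
theorem dot_congr_mulVec (T : Matrix κ ι ℝ) (M : Matrix κ κ ℝ) (c : ℝ) (u' u : ι → ℝ) :
    u' ⬝ᵥ (c • (Tᵀ * M * T)).mulVec u = c * (T.mulVec u' ⬝ᵥ M.mulVec (T.mulVec u)) := by
  rw [smul_mulVec, dotProduct_smul, smul_eq_mul, ← mulVec_mulVec, ← mulVec_mulVec, dotProduct_mulVec,
    vecMul_transpose]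

/-- **COERCIVITY OF A CONGRUENT OPERATOR**: `σ_M‖φ‖² ≤ ⟨φ,Mφ⟩` for all `φ`, `c_T‖u‖² ≤ ‖Tu‖²` for all `u`, `0 ≤ c`,
`0 ≤ σ_M` ⇒ `(c·σ_M·c_T)‖u‖² ≤ ⟨u,(c·TᵀMT)u⟩`. [folklore] -/
theorem coercive_congr (T : Matrix κ ι ℝ) (M : Matrix κ κ ℝ) {c σM cT : ℝ} (hc : 0 ≤ c) (hσ : 0 ≤ σM)
    (hM : ∀ φ : κ → ℝ, σM * (φ ⬝ᵥ φ) ≤ φ ⬝ᵥ M.mulVec φ)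
    (hT : ∀ u : ι → ℝ, cT * (u ⬝ᵥ u) ≤ T.mulVec u ⬝ᵥ T.mulVec u) (u : ι → ℝ) :
    c * σM * cT * (u ⬝ᵥ u) ≤ u ⬝ᵥ (c • (Tᵀ * M * T)).mulVec u := by
  rw [dot_congr_mulVec]
  have h1 := hM (T.mulVec u)
  have h2 := hT u
  have h3 : σM * (cT * (u ⬝ᵥ u)) ≤ σM * (T.mulVec u ⬝ᵥ T.mulVec u) := mul_le_mul_of_nonneg_left h2 hσ
  calc c * σM * cT * (u ⬝ᵥ u) = c * (σM * (cT * (u ⬝ᵥ u))) := by ring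
    _ ≤ c * (T.mulVec u ⬝ᵥ M.mulVec (T.mulVec u)) := mul_le_mul_of_nonneg_left (h3.trans h1) hc

omit [Fintype κ] in
/-- **WEIGHT COMPATIBILITY**: if `ρ′ x = ρ j` whenever `T x j ≠ 0`, then multiplying `u` by any function of `ρ` before
`T` equals multiplying `Tu` by the same function of `ρ′` after. [folklore] -/
theorem mulVec_weight_of_compat (T : Matrix κ ι ℝ) (ρ : ι → ℝ) (ρ' : κ → ℝ)
    (hT : ∀ x j, T x j ≠ 0 → ρ' x = ρ j) (f : ℝ → ℝ) (u : ι → ℝ) :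
    T.mulVec (fun j => f (ρ j) * u j) = fun x => f (ρ' x) * T.mulVec u x := by
  ext x
  simp only [mulVec, dotProduct, Finset.mul_sum]
  refine Finset.sum_congr rfl fun j _ => ?_
  by_cases h : T x j = 0
  · rw [h, zero_mul, zero_mul, mul_zero]
  · rw [hT x j h]; ring

/-- The conjugation-error double sum as a difference of bilinear forms:
`Σ_{jk}(e^{ρ_j−ρ_k} − 1)H_{jk}u_ju_k = ⟨e^{ρ}u, H e^{−ρ}u⟩ − ⟨u, Hu⟩`. [folklore] -/
theorem conjError_eq_dot {α : Type*} [Fintype α] (H : Matrix α α ℝ) (ρ u : α → ℝ) :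
    ∑ j, ∑ k, (Real.exp (ρ j - ρ k) - 1) * H j k * (u j * u k) =
      (fun j => Real.exp (ρ j) * u j) ⬝ᵥ H.mulVec (fun k => Real.exp (-ρ k) * u k) - u ⬝ᵥ H.mulVec u := by
  simp only [dotProduct, mulVec, Finset.mul_sum, ← Finset.sum_sub_distrib]
  refine Finset.sum_congr rfl fun j _ => Finset.sum_congr rfl fun k _ => ?_
  rw [Real.exp_sub, Real.exp_neg]
  have hk : Real.exp (ρ k) ≠ 0 := (Real.exp_pos _).ne'
  field_simp

/-- **COVARIANCE OF THE CONJUGATION ERROR** under a weight-compatible change of variables: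
`err_ρ(c·TᵀMT, u) = c·err_{ρ′}(M, Tu)`. [folklore] -/
theorem conjError_congr (T : Matrix κ ι ℝ) (M : Matrix κ κ ℝ) (c : ℝ) (ρ : ι → ℝ) (ρ' : κ → ℝ)
    (hT : ∀ x j, T x j ≠ 0 → ρ' x = ρ j) (u : ι → ℝ) :
    ∑ j, ∑ k, (Real.exp (ρ j - ρ k) - 1) * (c • (Tᵀ * M * T)) j k * (u j * u k) =
      c * ∑ x, ∑ y, (Real.exp (ρ' x - ρ' y) - 1) * M x y * (T.mulVec u x * T.mulVec u y) := by
  rw [conjError_eq_dot, conjError_eq_dot, dot_congr_mulVec, dot_congr_mulVec, ← mul_sub,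
    mulVec_weight_of_compat T ρ ρ' hT (fun t => Real.exp t) u,
    mulVec_weight_of_compat T ρ ρ' hT (fun t => Real.exp (-t)) u]

/-- **CONJUGATION-ERROR BOUND FOR A CONGRUENT OPERATOR**: `−κ_M‖φ‖² ≤ err_{ρ′}(M, φ)` for all `φ`,
`‖Tu‖² ≤ C_T‖u‖²`, `0 ≤ c, κ_M`, weight compatibility ⇒ `−(c·κ_M·C_T)‖u‖² ≤ err_ρ(c·TᵀMT, u)`. [folklore] -/
theorem conjError_congr_ge (T : Matrix κ ι ℝ) (M : Matrix κ κ ℝ) {c κM CT : ℝ} (hc : 0 ≤ c) (hκ : 0 ≤ κM)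
    (ρ : ι → ℝ) (ρ' : κ → ℝ) (hT : ∀ x j, T x j ≠ 0 → ρ' x = ρ j)
    (hM : ∀ φ : κ → ℝ, -κM * (φ ⬝ᵥ φ) ≤ ∑ x, ∑ y, (Real.exp (ρ' x - ρ' y) - 1) * M x y * (φ x * φ y))
    (hTup : ∀ u : ι → ℝ, T.mulVec u ⬝ᵥ T.mulVec u ≤ CT * (u ⬝ᵥ u)) (u : ι → ℝ) :
    -(c * κM * CT) * (u ⬝ᵥ u) ≤ ∑ j, ∑ k, (Real.exp (ρ j - ρ k) - 1) * (c • (Tᵀ * M * T)) j k * (u j * u k) := by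
  rw [conjError_congr T M c ρ ρ' hT]
  have h1 := hM (T.mulVec u)
  have h2 := hTup u
  have h3 : -κM * (CT * (u ⬝ᵥ u)) ≤ -κM * (T.mulVec u ⬝ᵥ T.mulVec u) :=
    mul_le_mul_of_nonpos_left h2 (by linarith)
  calc -(c * κM * CT) * (u ⬝ᵥ u) = c * (-κM * (CT * (u ⬝ᵥ u))) := by ring
    _ ≤ c * ∑ x, ∑ y, (Real.exp (ρ' x - ρ' y) - 1) * M x y * (T.mulVec u x * T.mulVec u y) :=
        mul_le_mul_of_nonneg_left (h3.trans h1) hc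

/-- A whole matrix on coarse ⊕ fine IS the block matrix of its four blocks (so `NE7K1LinSchurLineForm`'s `H₁ =
fromBlocks A₁ B C D` hypotheses can be fed with `A₁ := H.toBlocks₁₁`, …, for `H = c·TᵀMT`). [folklore] -/
theorem eq_fromBlocks_toBlocks {ιc ιf : Type*} (H : Matrix (ιc ⊕ ιf) (ιc ⊕ ιf) ℝ) :
    H = fromBlocks H.toBlocks₁₁ H.toBlocks₁₂ H.toBlocks₂₁ H.toBlocks₂₂ :=
  (fromBlocks_toBlocks H).symm

end Summit.QuantumFields.BalabanUV.T4Continuum.NE7K1LinSchurLineCoords
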